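import Summits.CriticalPhenomena.CardyFormulaZ2.Theses.CardyIKTransport
import Summits.CriticalPhenomena.CardyFormulaZ2.Theses.CardyDiluteOrbit
import Summits.CriticalPhenomena.CardyFormulaZ2.Theorems.IKMixedBoxCrossing.Negative.IKMixedBoxCrossingSmallModels
import Summits.CriticalPhenomena.CardyFormulaZ2.Theorems.IKMixedBoxCrossing.Negative.IKMixedBoxCrossingNoFKG
import Summits.CriticalPhenomena.CardyFormulaZ2.Theorems.IKMixedBoxCrossing.Negative.IKMixedBoxCrossingNoBondFKG

/-!
# Line `paired-mirror-exploration` for the crux `IKMixedBoxCrossing` (stmt-CriticalPhenomena-5911; decl shared verbatim by routes CardyDiluteOrbit — the item's home — and CardyIKTransport)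

Skeleton (crux-plan, round 1, planner `planner-cruxplan-stmt-CriticalPhenomena-5911-paired-mirror-explor-0`,
2026-08-16).  The crux is RSW for the column-mixed isotropic-IK / honeycomb family, UNIFORMLY over the column
pattern `S ⊆ ℤ`: `∃ c > 0, ∀ S, ∀ n ≥ 1, ∀ a b, c ≤ P_S[black LR crossing of the 2n × n box at (a,b)] ∧
c ≤ P_S[black BT crossing of the n × 2n box at (a,b)]`, over the explicit i.i.d.-bit gauge (named below exactly as
in the cdisprove file `Disproof.lean` §1: `μIK`, `par`, `blk`, `anti`, `edges`; `iff_cbox` is the definitional bridge).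

## The line, cut at its natural joints (six registered stubs)

The idea card's lever is Smirnov's symmetric-domain RSW step run on PAIRS of explorations, so that the involution
`Φ = flip ∘ reflection` acts on exploration pairs and the two model inputs of the tree's proof for `𝕋`
(`SmirnovRSW.real_Eev_inter_Bev` = independence, and the Harris step of `TriThetaHalf.rsw_doubling`) are replaced
by an exact symmetry plus the exact column-Markov property of the plaquette field — no positive association
(honouring `Disproof.colourField_not_positivelyAssociated` / `bondField_not_positivelyAssociated`).  Its abstract
core `paired_symmetrisation` is PROVED below (§2, no `sorry`).  The triage panel (r1-1/2/3: pass ×3) fixed the scope: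
the horizontal doubling needs a mirror-symmetric column pattern, which every ISOTROPIC-PURE box has and a general
pattern has not (β); the vertical doubling uses the seam-sheared involution `Ψ_S`, exact for EVERY `S`; the junction
estimate (α) is open; the `∀S` layer is the shared residual of all nine ideas.  Accordingly:

* `stub_pairedMirrorDoubling` — THE LEVER: FKG-free Smirnov doubling for the isotropic model (pattern `univ`),
  in the threshold form `∀ c₀ > 0 ∃ c₁ > 0, P[LR(w × h)] ≥ c₀ ⇒ P[LR((2w+1) × h)] ≥ c₁` (absorbs the admissibility
  error `ε = h^{-9}` of step (2) and the finite-energy treatment of tiny boxes).  OPEN (junction (α)); size XL.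
* `stub_crossingCalculus` — for EVERY `S`: self-duality `P_S[LR(w×h)] + P_S[TB(w×h)] = 1` (one diagonal per face +
  colour flip; triage F5) and monotonicity in the crossed length (path truncation).  Provable now; size L.
* `stub_isotropicInvariance` — gauge locality + translations (an isotropic-pure box has the `S = univ` law) and the
  exact quarter turn of the isotropic gauge (the route's support item IKQuarterTurn, stmt-10900, as a box identity).
  Provable now (bit bijections of the product measure); size L.
* `stub_squareNondegeneracy` — for EVERY `S`, squares are crossed both ways with probability `≥ c` (by duality: the
  LR probability of every square lies in `[c, 1−c]`): the a-priori "no anisotropy blow-up" half of the `∀S` layer,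
  the base the vertical engine consumes (triage r1-3 sharpen).  OPEN; size L–XL.
* `stub_shearedMirrorDoubling` — the card's step (4): vertical doubling for EVERY `S` through the exact involution
  `Ψ_S = (shift the k-th seam block down by k) ∘ (reflection in a horizontal line)` (+ flip), SHARPENED by this seat:
  placing the mirror image of the `w × h` box `R` below it with a gap of `j + 1` rows in the `j`-th seam block makes
  `R' = ⋃_j B_j × [b−h−1−j, b+h−1]` exactly `Ψ_S`-invariant with a common full-width band of height `2h + 1`, so the
  doubled height is `2h + 1` with NO seam loss (the card's `2b − d` was pessimistic).  OPEN (junction (α), uniformly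
  in `S`); size XL.  With stubs 2(b) and 4 it yields the crux's TALL clause for every `S` in one step.
* `stub_patternUniformisation` — the `∀S` layer proper ("doubling within runs + seam gluing", triage r1-2 sharpen;
  = the ThinRunRenewal / IK-side two-point input named by r1-1 and r1-3): RSW for isotropic-pure boxes at every
  aspect ratio + square non-degeneracy + the all-`S` vertical doubling ⇒ the crux (stated over the named pieces,
  NOT by the crux's name, so that `IKMixedBoxCrossing_of` is the only theorem of the file concluding the crux).
  Its live content is the WIDE clause for patterns that are not mirror-symmetric in the box (the tall clause and
  `n = 1` follow at once from its hypotheses and the `1/4` datum).  OPEN; size XL; shared with cards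
  curtain-contact-gluing / strip-factorisation-fresh-seams.

Logical position (recorded, not hidden): given stub 3, stub 5 at `S = univ` implies stub 1 (quarter turn); stub 1 is
filed separately because it is the isotropic member that CardyIK (stmt-5913) and IKLinearTransport consume and the
first target of the lead, stub 5 its all-`S` extension feeding only the `∀S` layer.

`IKMixedBoxCrossing_of` (no `sorry`) iterates the lever from the exact value `P_univ[LR(n×n)] = 1/2`
(duality + quarter turn) along the widths `dblWidth k n = 2^k (n+1) − 1 ≥ (k+1) n`, transports the bounds to every
isotropic-pure box in both directions (`isotropicRSW_of`), and hands the result with stubs 4–5 to stub 6; the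
bridge `iff_cbox` turns the named form into the route decl BY NAME.  The item's decl exists twice with the same body
(`CardyDiluteOrbit.IKMixedBoxCrossing`, the item's home route, which `ledger skeleton check` audits by default, and
`CardyIKTransport.IKMixedBoxCrossing`, this unit's payload route; `diluteOrbit_iff_transport : _ ↔ _ := Iff.rfl`), so the
file concludes BOTH by name: `IKMixedBoxCrossing_of` (CardyDiluteOrbit) and `IKMixedBoxCrossing_of_CardyIKTransport`.

## Disproof used (Disproof.lean, cdisprove cycles 1–2, read 2026-08-16T05:30Z)

`iKMixedBoxCrossing_false_without_n_pos` (n = 0 empties the source side): honoured — `1 ≤ n` is kept verbatim in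
stub 6's conclusion and in `iff_cbox`; every other stub carries explicit non-degeneracy side conditions (`2 ≤ h`,
`2 ≤ w`, `1 ≤ w`), because in this gauge a 1-wide box is crossed the short way SURELY (`openConnIn` with `x = y`) and a
0-wide box never.  `pH_one_zero_zero` / `c_le_quarter` / `not_IKMixedBoxCrossing_with_large_constant`: respected —
all constants are existential outputs of `∀ c₀ ∃ c₁` steps started at `1/2`; nothing asserts `c > 1/4`.
`colourField_not_positivelyAssociated`, `bondField_not_positivelyAssociated`: honoured — no stub asserts or uses
positive association; stub 1 is by construction the FKG-free doubling (H = the exact `Φ`-symmetry + column Markov),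
stub 5 likewise with `Ψ_S` + row Markov.  LANDED Negative lemmas (imported above so the check sees them):
`Theorems/IKMixedBoxCrossing/Negative/IKMixedBoxCrossingSmallModels` (`iff_named`, `iKMixedBoxCrossing_false_without_n_pos`,
`pH_one_zero_zero`, `c_le_quarter`, `not_IKMixedBoxCrossing_with_large_constant`), `…NoFKG`
(`colourField_not_positivelyAssociated`), `…NoBondFKG` (`bondField_not_positivelyAssociated`) — the same content; no stub is an
instance they refute (§7 records the two bridges: stub 6's conclusion IS the disprover's named crux, and its constant is
`≤ 1/4`).  Negatives index of the summit (9 refuted, none on RSW / the IK plaquette field): unrelated.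
-/

noncomputable section

namespace Summit.CriticalPhenomena.CardyFormulaZ2.Cruxes.IKMixedBoxCrossing.PairedMirrorExploration

open scoped Classical
open MeasureTheory
open Literature.Probability.Percolation Literature.Probability.LatticeModels

/-! ## §0 The explicit gauge, named (verbatim the crux's `let`s; identical to `Disproof.lean` §1) -/

/-- Bit space of the gauge: column signs `A ⊆ ℤ` × row signs `B ⊆ ℤ` × biased plaquettes × fair plaquettes ×
diagonal coins. -/
abbrev Ω : Type := Set ℤ × (Set ℤ × (Set (Site 2) × (Set (Site 2) × Set (Site 2))))

/-- The gauge measure (a product probability measure, independent of the column pattern `S`). -/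
def μIK : Measure Ω :=
  (sitePercolation ℤ half).prod ((sitePercolation ℤ half).prod
    ((sitePercolation (Site 2) (Set.projIcc (0:ℝ) 1 zero_le_one (2 * Real.sqrt 3 - 3))).prod
      ((sitePercolation (Site 2) half).prod (sitePercolation (Site 2) half))))

/-- Plaquette defect at the face with lower-left cell `f`: biased bit on `S`-columns, fair bit elsewhere. -/
def par (S : Set ℤ) (ω : Ω) (f : Site 2) : Prop :=
  (f 0 ∈ S ∧ f ∈ ω.2.2.1) ∨ (f 0 ∉ S ∧ f ∈ ω.2.2.2.1)

/-- Black cell: column sign ⊕ row sign ⊕ parity of the defects in the rectangle between `0` and `v`. -/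
def blk (S : Set ℤ) (ω : Ω) (v : Site 2) : Prop :=
  Xor (v 0 ∈ ω.1) (Xor (v 1 ∈ ω.2.1) (Odd ((Finset.filter (fun f : ℤ × ℤ => par S ω ![f.1, f.2])
    (Finset.Ico (min 0 (v 0)) (max 0 (v 0)) ×ˢ Finset.Ico (min 0 (v 1)) (max 0 (v 1)))).card)))

/-- The face `f` carries the ANTI-diagonal: forced off `S` (honeycomb columns), a fair coin on `S`. -/
def anti (S : Set ℤ) (ω : Ω) (f : Site 2) : Prop := f 0 ∉ S ∨ f ∈ ω.2.2.2.2

/-- Open bonds: nearest-neighbour and chosen-diagonal pairs of black cells. -/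
def edges (S : Set ℤ) (ω : Ω) : BondConfig (Site 2) :=
  {e | ∃ u v, e = s(u, v) ∧ blk S ω u ∧ blk S ω v ∧ (v = u + ![1, 0] ∨ v = u + ![0, 1] ∨
    (v = u + ![1, 1] ∧ ¬ anti S ω u) ∨ (v = u + ![1, -1] ∧ anti S ω (u + ![0, -1])))}

/-! ## §1 Cell boxes of every shape, their sides, crossing events and crossing probabilities -/

/-- The `w × h` box of cells with lower-left cell `(a, b)`. -/
def cbox (a b : ℤ) (w h : ℕ) : Set (Site 2) := {v | a ≤ v 0 ∧ v 0 < a + w ∧ b ≤ v 1 ∧ v 1 < b + h}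

/-- Its west (left) column. -/
def sideW (a b : ℤ) (h : ℕ) : Set (Site 2) := {v | v 0 = a ∧ b ≤ v 1 ∧ v 1 < b + h}

/-- Its east (right) column. -/
def sideE (a b : ℤ) (w h : ℕ) : Set (Site 2) := {v | v 0 = a + w - 1 ∧ b ≤ v 1 ∧ v 1 < b + h}

/-- Its south (bottom) row. -/
def sideS (a b : ℤ) (w : ℕ) : Set (Site 2) := {v | v 1 = b ∧ a ≤ v 0 ∧ v 0 < a + w}

/-- Its north (top) row. -/
def sideN (a b : ℤ) (w h : ℕ) : Set (Site 2) := {v | v 1 = b + h - 1 ∧ a ≤ v 0 ∧ v 0 < a + w}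

/-- Black west–east crossing EVENT of the `w × h` box at `(a, b)` under the column pattern `S`. -/
def lrEvent (S : Set ℤ) (a b : ℤ) (w h : ℕ) : Set Ω :=
  {ω | edges S ω ∈ openCrossing (cbox a b w h) (sideW a b h) (sideE a b w h)}

/-- Black south–north crossing EVENT of the `w × h` box at `(a, b)` under the column pattern `S`. -/
def tbEvent (S : Set ℤ) (a b : ℤ) (w h : ℕ) : Set Ω :=
  {ω | edges S ω ∈ openCrossing (cbox a b w h) (sideS a b w) (sideN a b w h)}

/-- `P_S[black LR crossing of the w × h box at (a,b)]`. -/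
def pLR (S : Set ℤ) (a b : ℤ) (w h : ℕ) : ℝ := μIK.real (lrEvent S a b w h)

/-- `P_S[black BT crossing of the w × h box at (a,b)]`. -/
def pTB (S : Set ℤ) (a b : ℤ) (w h : ℕ) : ℝ := μIK.real (tbEvent S a b w h)

/-- The two copies of the crux decl (routes CardyDiluteOrbit and CardyIKTransport share the item and its text) are
definitionally the same proposition. -/
theorem diluteOrbit_iff_transport :
    Summit.CriticalPhenomena.CardyFormulaZ2.Theses.CardyDiluteOrbit.IKMixedBoxCrossing ↔
      Summit.CriticalPhenomena.CardyFormulaZ2.Theses.CardyIKTransport.IKMixedBoxCrossing :=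
  Iff.rfl

/-- BRIDGE (definitional): the crux (item's home decl), verbatim, is the aspect-ratio-2 case of `pLR`/`pTB`. -/
theorem iff_cbox :
    Summit.CriticalPhenomena.CardyFormulaZ2.Theses.CardyDiluteOrbit.IKMixedBoxCrossing ↔
      ∃ c : ℝ, 0 < c ∧ ∀ S : Set ℤ, ∀ n : ℕ, 1 ≤ n → ∀ a b : ℤ,
        c ≤ pLR S a b (2 * n) n ∧ c ≤ pTB S a b n (2 * n) := by
  simp only [Summit.CriticalPhenomena.CardyFormulaZ2.Theses.CardyDiluteOrbit.IKMixedBoxCrossing, pLR, pTB, lrEvent,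
    tbEvent, cbox, sideW, sideE, sideS, sideN, edges, blk, anti, par, μIK, Nat.cast_mul, Nat.cast_ofNat]

/-- The same bridge for the CardyIKTransport copy of the decl. -/
theorem iff_cbox_transport :
    Summit.CriticalPhenomena.CardyFormulaZ2.Theses.CardyIKTransport.IKMixedBoxCrossing ↔
      ∃ c : ℝ, 0 < c ∧ ∀ S : Set ℤ, ∀ n : ℕ, 1 ≤ n → ∀ a b : ℤ,
        c ≤ pLR S a b (2 * n) n ∧ c ≤ pTB S a b n (2 * n) :=
  diluteOrbit_iff_transport.symm.trans iff_cbox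

/-- All cell columns `a ≤ x < a + w` are isotropic (`S`-)columns: the box is ISOTROPIC-PURE, its law is the
isotropic Izergin–Korepin law whatever `S` does elsewhere. -/
def IsoCols (S : Set ℤ) (a : ℤ) (w : ℕ) : Prop := ∀ x : ℤ, a ≤ x → x < a + w → x ∈ S

/-! ## §2 The lever, PROVED: paired symmetrisation (card `paired-mirror-exploration`, First lemma)

For a measure-preserving `Φ` and a `Φ`-equivariant finite family of exploration events `E i`
(`Φ ⁻¹' E (i⋆) = E i`, `⋆` an involution of the index set), if on each `E i` one of `B i` or `Φ ⁻¹' B (i⋆)` occurs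
(pathwise planar duality), then `∑ P(E i) ≤ 2 ∑ P(E i ∩ B i)` — no positive association, no domain Markov property.
This is what replaces, in Smirnov's doubling, both the independence `P(B(L₀) | L = L₀) = P(B(L₀))` and the Harris
step; triage r1-1/2/3 verified it on paper, here it is kernel-checked. -/

theorem paired_symmetrisation {Ω' : Type*} [MeasurableSpace Ω'] (P : Measure Ω') [IsProbabilityMeasure P]
    (Φ : Ω' → Ω') (hΦ : MeasurePreserving Φ P P) {ι : Type*} (s : Finset ι) (star : ι → ι)
    (hstar : ∀ i ∈ s, star i ∈ s) (hinv : ∀ i, star (star i) = i)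
    (E B : ι → Set Ω') (hE : ∀ i, MeasurableSet (E i)) (hB : ∀ i, MeasurableSet (B i))
    (hΦE : ∀ i, Φ ⁻¹' (E (star i)) = E i)
    (hdual : ∀ i ∈ s, E i ⊆ B i ∪ Φ ⁻¹' (B (star i))) :
    ∑ i ∈ s, P.real (E i) ≤ 2 * ∑ i ∈ s, P.real (E i ∩ B i) := by
  have step1 : ∀ i ∈ s, P.real (E i) ≤ P.real (E i ∩ B i) + P.real (E (star i) ∩ B (star i)) := by
    intro i hi
    have hsub : E i ⊆ (E i ∩ B i) ∪ Φ ⁻¹' (E (star i) ∩ B (star i)) := by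
      intro ω hω
      rcases hdual i hi hω with h | h
      · exact Or.inl ⟨hω, h⟩
      · have hω' : ω ∈ Φ ⁻¹' (E (star i)) := by rw [hΦE]; exact hω
        exact Or.inr ⟨hω', h⟩
    calc P.real (E i) ≤ P.real ((E i ∩ B i) ∪ Φ ⁻¹' (E (star i) ∩ B (star i))) := measureReal_mono hsub
      _ ≤ P.real (E i ∩ B i) + P.real (Φ ⁻¹' (E (star i) ∩ B (star i))) := measureReal_union_le _ _
      _ = P.real (E i ∩ B i) + P.real (E (star i) ∩ B (star i)) := by
        congr 1
        rw [measureReal_def, measureReal_def, hΦ.measure_preimage ((hE _).inter (hB _)).nullMeasurableSet]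
  have step2 : ∑ i ∈ s, P.real (E (star i) ∩ B (star i)) = ∑ i ∈ s, P.real (E i ∩ B i) :=
    Finset.sum_nbij' star star hstar hstar (fun i _ => hinv i) (fun i _ => hinv i) (fun _ _ => rfl)
  calc ∑ i ∈ s, P.real (E i) ≤ ∑ i ∈ s, (P.real (E i ∩ B i) + P.real (E (star i) ∩ B (star i))) :=
        Finset.sum_le_sum step1
    _ = ∑ i ∈ s, P.real (E i ∩ B i) + ∑ i ∈ s, P.real (E (star i) ∩ B (star i)) := Finset.sum_add_distrib
    _ = 2 * ∑ i ∈ s, P.real (E i ∩ B i) := by rw [step2]; ring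

/-! ## §3 The six stub STATEMENTS (named `Prop`s; the registered `stub_*` theorems of §4 restate them verbatim,
`*_holds` certify the agreement definitionally, and `Registered.stub_*` are the name-keyed aliases used as the
hypotheses of `IKMixedBoxCrossing_of` — the skeleton audit admits a hypothesis by the last component of its head
name; same device as `Summits/ABC/ABC/Cruxes/SomeWindowSaving/Lines/inert-box-collapse.lean`) -/

/-- STUB 1 statement — FKG-FREE SMIRNOV DOUBLING FOR THE ISOTROPIC MODEL (the card's steps (1)–(3), horizontal):
for the isotropic pattern `S = univ` (all columns IK: every doubled box `R ∪ axis ∪ ρR` is mirror-symmetric and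
`Φ = flip ∘ ρ` is an exact automorphism of the gauge's percolation structure), a uniform lower bound for black LR
crossings of `w × h` boxes gives a uniform lower bound for black LR crossings of the doubled `(2w+1) × h` boxes.
Threshold form: the admissibility error of step (2) (`P(adm) ≥ (p − h^{-9})²`, disagreement/Walsh decorrelation
after shaving `r = C log h` columns) and tiny boxes (all-black has probability `≥ 2^{-(w+h-1)} (1+t)^{-(w-1)(h-1)}`)
are absorbed in the choice of `c₁(c₀)`. -/
def PairedMirrorDoubling : Prop :=
  ∀ c₀ : ℝ, 0 < c₀ → ∃ c₁ : ℝ, 0 < c₁ ∧ ∀ (a b : ℤ) (w h : ℕ), 1 ≤ w → 2 ≤ h →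
    c₀ ≤ pLR Set.univ a b w h → c₁ ≤ pLR Set.univ a b (2 * w + 1) h

/-- STUB 2 statement — CROSSING CALCULUS, EVERY `S`: (a) self-duality of the one-diagonal-per-face cell
triangulation + colour flip `A ↦ Aᶜ` (exact symmetry of `μIK`, `anti` untouched): for `w, h ≥ 2` exactly one of
{black LR, white TB} occurs, so `P_S[LR(w×h)] + P_S[TB(w×h)] = 1`; (b) crossing a longer box the long way is harder:
`pLR` is antitone in the width (from `w ≥ 1`), `pTB` antitone in the height (from `h ≥ 1`) — a LR crossing of the
wider box, stopped at its first visit to column `a + w − 1`, is a LR crossing of the narrower one (bonds join cells at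
column distance `≤ 1`). -/
def CrossingCalculus : Prop :=
  (∀ (S : Set ℤ) (a b : ℤ) (w h : ℕ), 2 ≤ w → 2 ≤ h → pLR S a b w h + pTB S a b w h = 1) ∧
  (∀ (S : Set ℤ) (a b : ℤ) (w w' h : ℕ), 1 ≤ w → w ≤ w' → pLR S a b w' h ≤ pLR S a b w h) ∧
  (∀ (S : Set ℤ) (a b : ℤ) (w h h' : ℕ), 1 ≤ h → h ≤ h' → pTB S a b w h' ≤ pTB S a b w h)

/-- STUB 3 statement — ISOTROPIC INVARIANCE: (a) gauge locality + translation covariance: the law of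
(colours, diagonals) restricted to an isotropic-pure box is the free plaquette field of that box with `t = √3/2` on
every interior face and fair coins (triage F1/F2), the same as under `S = univ` at the origin, so both crossing
probabilities agree; (b) the exact quarter turn of the isotropic gauge (`ρ(v) = (−v₁, v₀)`, bit bijection
`A'_m = A₀ ⊕ B₀ ⊕ B₋ₘ`, `B'_n = A₀ ⊕ B₀ ⊕ Aₙ`, plaquettes permuted, coins permuted-and-flipped; the route's support
item IKQuarterTurn, stmt-CriticalPhenomena-10900) maps the BT crossing of the `w × h` box to the LR crossing of an
`h × w` box, then (a) recentres it. -/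
def IsotropicInvariance : Prop :=
  (∀ (S : Set ℤ) (a b : ℤ) (w h : ℕ), IsoCols S a w →
      pLR S a b w h = pLR Set.univ 0 0 w h ∧ pTB S a b w h = pTB Set.univ 0 0 w h) ∧
  (∀ w h : ℕ, pTB Set.univ 0 0 w h = pLR Set.univ 0 0 h w)

/-- STUB 4 statement — SQUARE NON-DEGENERACY, EVERY `S`: squares are crossed in BOTH directions with probability
bounded below uniformly in the pattern, the side `n ≥ 2` and the position (with stub 2(a): `P_S[LR(n×n)] ∈ [c, 1−c]`).
The a-priori half of the `∀S` layer: it excludes unbounded effective anisotropy along some pattern sequence `S_n` —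
the only way the crux can fail (Disproof `why_it_resists` items 2, 5); numerically squares lie in `[0.47, 0.53]` for
every pattern tested up to `n = 32` (kit j012395 Part D, j008691, j010071), and the laminate heuristic (triage r1-1
F6) predicts `≤ 7 %` effective anisotropy for all mixtures. -/
def SquareNondegeneracy : Prop :=
  ∃ c : ℝ, 0 < c ∧ ∀ (S : Set ℤ) (a b : ℤ) (n : ℕ), 2 ≤ n → c ≤ pLR S a b n n ∧ c ≤ pTB S a b n n

/-- STUB 5 statement — SHEARED-MIRROR VERTICAL DOUBLING, EVERY `S` (the card's step (4), sharpened): with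
`j(x)` = number of honeycomb seams (interior face columns `s ∉ S`) of the box strictly left of column `x`, the map
`Ψ_S (x, y) = (x, 2b − 2 − y − j(x))` is an involution and — composed with the colour flip and the coin relabelling —
an EXACT automorphism of the percolation structure of `μIK` for every `S` (blocks between seams are independent and
`y`-stationary by curtain independence, triage F5; inside a block it is a reflection, main ↔ anti with fair coins;
across a seam it swaps {H, anti} ↔ {anti, H}; r1-1/r1-2 verified).  The staircase region
`R' = ⋃_x {x} × [b−h−1−j(x), b+h−1]` is `Ψ_S`-invariant, contains the box `R = [a,a+w) × [b,b+h)` and its image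
`Ψ_S R` separated by `j(x) + 1 ≥ 1` gap rows (the fat axis of `SmirnovRSW`), and its common full-width band is
`[a,a+w) × [b−h−1, b+h−1]`, of height `2h + 1`: a top-to-bottom crossing of `R'` crosses that band.  Running the paired
argument (explore from the west side; exact ROW-Markov property for admissibility: given one full row the two
half-planes are independent, Walsh factor `0` through a honeycomb face and `≤ ρ` otherwise) doubles BT crossings
vertically with NO seam loss; `y`-stationarity puts the conclusion back at `(a, b)`.  Threshold form as in stub 1. -/
def ShearedMirrorDoubling : Prop :=
  ∀ c₀ : ℝ, 0 < c₀ → ∃ c₁ : ℝ, 0 < c₁ ∧ ∀ (S : Set ℤ) (a b : ℤ) (w h : ℕ), 2 ≤ w → 1 ≤ h →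
    c₀ ≤ pTB S a b w h → c₁ ≤ pTB S a b w (2 * h + 1)

/-- RSW FOR ISOTROPIC-PURE BOXES AT EVERY ASPECT RATIO, both directions, every position and every pattern `S`
making the box isotropic-pure — the output of stubs 1–3 (`isotropicRSW_of`, proved) and the first hypothesis of
stub 6.  (The honeycomb-pure counterpart is a THEOREM of the tree — `Literature.Probability.Percolation.tri_rsw_half_holds`
— up to the anti-diagonal ↔ brick dictionary, so it is not carried as a hypothesis.) -/
def IsotropicRSW : Prop :=
  ∀ k : ℕ, ∃ c : ℝ, 0 < c ∧
    (∀ (S : Set ℤ) (a b : ℤ) (w h : ℕ), 2 ≤ h → h ≤ w → w ≤ k * h → IsoCols S a w → c ≤ pLR S a b w h) ∧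
    (∀ (S : Set ℤ) (a b : ℤ) (w h : ℕ), 2 ≤ w → w ≤ h → h ≤ k * w → IsoCols S a w → c ≤ pTB S a b w h)

/-- STUB 6 statement — PATTERN UNIFORMISATION (the `∀S` layer; "doubling within runs + seam gluing"): RSW for
isotropic-pure boxes at every aspect ratio (every maximal IK run of a box is such a box), square non-degeneracy for
every pattern, and the all-`S` vertical doubling of stub 5 imply the crux — stated over the named pieces (conclusion
= the right-hand side of `iff_cbox`, verbatim), not by the crux's name.  Content left to prove: gluing run crossings
across seams (exact independence across a honeycomb face-column, triage F5; `ρ = 7 − 4√3` Walsh decorrelation per IK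
face-column, F6) with a renewal control of thin runs (ThinRunRenewal, r1-1) and an IK-side boundary two-point /
quasi-multiplicativity input for IK–IK seams (r1-3); the honeycomb side has the tree's `𝕋` technology. -/
def PatternUniformisation : Prop :=
  IsotropicRSW → SquareNondegeneracy → ShearedMirrorDoubling →
    ∃ c : ℝ, 0 < c ∧ ∀ S : Set ℤ, ∀ n : ℕ, 1 ≤ n → ∀ a b : ℤ, c ≤ pLR S a b (2 * n) n ∧ c ≤ pTB S a b n (2 * n)

/-! ## §4 The registered stubs (`sorry` lives only in these six theorems) -/

/-- **STUB 1 · `stub_pairedMirrorDoubling`** (= `PairedMirrorDoubling` verbatim) — the line's load-bearing lever: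
FKG-free Smirnov doubling for the isotropic Izergin–Korepin gauge.  Proof plan (card (1)–(3) + triage sharpenings):
sum `paired_symmetrisation` (§2, proved) over exploration PAIRS (top white cluster `L₀` of the left half, top black
cluster `L₁` of the mirror half, frozen sets kept off the fat axis column as in `SmirnovRSW.not_adj_blackMass_rhoJ`),
padding duality in `D(π)` by the Hex lemma for the one-diagonal cell triangulation; admissibility
`P(adm) = E[g_r(ζ) g_r(ζ̄)] ≥ (p − ε)²` from the exact column-Markov factorisation (first MODEL lemma, r1-1 sharpen)
and `ρ^r`-decorrelation (`ρ = 7 − 4√3`, F6); gluing WITHOUT Harris by "hitting-gluing" — the junction estimate (α) is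
the open point (O(1) cost uniformly, expected to reduce to a smaller-scale crossing input along a black wall; the
free-boundary closure-exploration of card defect-closure-exploration makes the law behind the explored cluster EXACT).
Why plausibly true: it is Smirnov's lemma with its two probabilistic inputs replaced by exact structure this gauge
has; numerically `P[LR((2w+1)×h)]/P[LR(w×h)]²` is flat in scale for the isotropic model (refuter MC on stmt-5076 /
kit j012395).  Size XL (open).  Leans on: `SmirnovRSW.lean`, `TriThetaHalf.lean` (template), `cornerGibbsMeasure_map_flip`,
`CellSymmetry.reflect`, `cellCrossing_duality_holds`, `paired_symmetrisation`. -/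
theorem stub_pairedMirrorDoubling :
    ∀ c₀ : ℝ, 0 < c₀ → ∃ c₁ : ℝ, 0 < c₁ ∧ ∀ (a b : ℤ) (w h : ℕ), 1 ≤ w → 2 ≤ h →
      c₀ ≤ pLR Set.univ a b w h → c₁ ≤ pLR Set.univ a b (2 * w + 1) h := by
  sorry

/-- **STUB 2 · `stub_crossingCalculus`** (= `CrossingCalculus` verbatim) — PROVABLE NOW, size L: (a) the Hex-lemma
duality for the `w × h` cell box with one diagonal per face (Gale's argument / the tree's `cellCrossing_duality_holds`
pattern and `tri_hex_para`), plus the measure-preserving flip of the fair column signs `A ↦ Aᶜ` which swaps black and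
white and fixes `anti`; (b) pathwise inclusions `lrEvent S a b w' h ⊆ lrEvent S a b w h` (`1 ≤ w ≤ w'`) and the TB
analogue, by truncating an open path at its first visit to the far column/row (`SimpleGraph.Walk` surgery; every bond
of `edges` joins cells at sup-distance 1).  Side conditions are load-bearing: a 1-wide box is LR-crossed surely. -/
theorem stub_crossingCalculus :
    (∀ (S : Set ℤ) (a b : ℤ) (w h : ℕ), 2 ≤ w → 2 ≤ h → pLR S a b w h + pTB S a b w h = 1) ∧
    (∀ (S : Set ℤ) (a b : ℤ) (w w' h : ℕ), 1 ≤ w → w ≤ w' → pLR S a b w' h ≤ pLR S a b w h) ∧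
    (∀ (S : Set ℤ) (a b : ℤ) (w h h' : ℕ), 1 ≤ h → h ≤ h' → pTB S a b w h' ≤ pTB S a b w h) := by
  sorry

/-- **STUB 3 · `stub_isotropicInvariance`** (= `IsotropicInvariance` verbatim) — PROVABLE NOW, size L ("no new
mathematics", product-measure bijections): (a) for an isotropic-pure box the joint law of (`blk` on the box, `anti` on
its interior faces) under `μIK` does not depend on (`S` off the box, `a`, `b`): the bit→colour map is 2-to-1 onto the
free plaquette field of the box (uniform first row/column ⊕ independent Bernoulli(2√3−3) face parities), refuter
read-backs on stmt-5911 and triage F1–F2; (b) the quarter-turn bit bijection of IKQuarterTurn (stmt-10900) carries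
`tbEvent univ 0 0 w h` onto the LR event of the box `cbox (1−h) 0 h w`, then (a). -/
theorem stub_isotropicInvariance :
    (∀ (S : Set ℤ) (a b : ℤ) (w h : ℕ), IsoCols S a w →
        pLR S a b w h = pLR Set.univ 0 0 w h ∧ pTB S a b w h = pTB Set.univ 0 0 w h) ∧
    (∀ w h : ℕ, pTB Set.univ 0 0 w h = pLR Set.univ 0 0 h w) := by
  sorry

/-- **STUB 4 · `stub_squareNondegeneracy`** (= `SquareNondegeneracy` verbatim) — OPEN, size L–XL: uniform
two-sided non-degeneracy of SQUARE crossings over all column patterns.  Strictly weaker than the crux (sub-box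
inclusion), and the cleanest kill criterion of the whole `∀S` layer: a pattern family `S_n` with
`P_{S_n}[LR(n×n)] → 0` or `→ 1` refutes it, the crux, and both routes' use of mixed rows.  Inputs available for every
`S`: the exact identity of stub 2(a), the XOR-flip conditional duality `max(P(LR | ext), P(TB | ext)) ≥ 9/25`
(cards xor-rectangle-flip / xor-corner-conditional-duality), curtain independence and `ρ`-decorrelation (F5–F6); what
is missing is a symmetry exchanging the two directions for mixed `S` (only `S ∈ {∅, univ}` have one). -/
theorem stub_squareNondegeneracy :
    ∃ c : ℝ, 0 < c ∧ ∀ (S : Set ℤ) (a b : ℤ) (n : ℕ), 2 ≤ n → c ≤ pLR S a b n n ∧ c ≤ pTB S a b n n := by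
  sorry

/-- **STUB 5 · `stub_shearedMirrorDoubling`** (= `ShearedMirrorDoubling` verbatim) — OPEN, size XL: the card's
all-`S` lever.  Same proof plan as stub 1 in the vertical direction with `Φ_V = flip ∘ Ψ_S` (exact for every `S`), the
`Ψ_S`-invariant staircase region `R'` of the statement's docstring as the doubled domain (gap rows = fat axis), and
the exact row-Markov property for admissibility.  Consequences: with stubs 2(b) and 4 the TALL clause of the crux for
every `S` (`n × n → n × (2n+1) ⊇ n × 2n`); at `S = univ` and with stub 3(b) it implies stub 1.  Why it might fail beyond
stub 1: the junction estimate (α) must now be uniform in the pattern `S` (honeycomb seams inside the explored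
clusters); degenerate regimes are harmless (`h = 1` is the sure event and `P_S[TB(w × 3)] ≥ 2^{-6}` uniformly;
`w = 2` forces `h ≤ H(c₀)` by the `(3/4)^h`-type decay of 2-wide vertical crossings). -/
theorem stub_shearedMirrorDoubling :
    ∀ c₀ : ℝ, 0 < c₀ → ∃ c₁ : ℝ, 0 < c₁ ∧ ∀ (S : Set ℤ) (a b : ℤ) (w h : ℕ), 2 ≤ w → 1 ≤ h →
      c₀ ≤ pTB S a b w h → c₁ ≤ pTB S a b w (2 * h + 1) := by
  sorry

/-- **STUB 6 · `stub_patternUniformisation`** (= `PatternUniformisation` verbatim) — OPEN, size XL, the `∀S`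
layer proper and the stub this line shares with every other line on the crux (triage: "no card closes ∀S").
Given: RSW for isotropic-pure boxes at all aspect ratios and positions (`IsotropicRSW`), square non-degeneracy for all
patterns, vertical doubling for all patterns.  To prove: the aspect-2 bounds of the crux for every `S` — the tall
clause is immediate (squares `≥ c` → one vertical doubling → height `2n+1 ⊇ 2n` by monotonicity; `n = 1` is the `1/4`
datum of Disproof §3), so the live content is the WIDE clause for patterns with no mirror symmetry.  Mechanism on
offer (r1-2 sharpen "doubling within runs + seam gluing"): decompose the box's columns into maximal IK runs (each an
isotropic-pure box: `IsotropicRSW`) and honeycomb runs (tree: `tri_rsw_half_holds` + the 𝕋 arm/BK/quasi-multiplicative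
technology), glue across seams using EXACT independence across honeycomb face-columns (F5) and `ρ = 0.0718`
decorrelation across IK face-columns (F6); the named open inputs are ThinRunRenewal (periodic fine mixtures, r1-1) and
an IK-side boundary two-point bound for IK–IK seams (r1-3, `S = ℤ ∖ {x₀}`).  Why plausibly true: squares pinned by
hypothesis 2, both pure media RSW, exact renewal structure at seams; numerically the long-way probabilities of all
patterns lie between the two pure limits `0.1512` (𝕋) and `0.1756…0.21` with spread `≤ 0.03` and no drift to `n = 256`
(Disproof §5, kit j008097/j012395/j013031). -/
theorem stub_patternUniformisation :
    IsotropicRSW → SquareNondegeneracy → ShearedMirrorDoubling →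
      ∃ c : ℝ, 0 < c ∧ ∀ S : Set ℤ, ∀ n : ℕ, 1 ≤ n → ∀ a b : ℤ,
        c ≤ pLR S a b (2 * n) n ∧ c ≤ pTB S a b n (2 * n) := by
  sorry

/-! ### Consistency: each named statement IS its registered stub (definitionally) -/

theorem pairedMirrorDoubling_holds : PairedMirrorDoubling := stub_pairedMirrorDoubling
theorem crossingCalculus_holds : CrossingCalculus := stub_crossingCalculus
theorem isotropicInvariance_holds : IsotropicInvariance := stub_isotropicInvariance
theorem squareNondegeneracy_holds : SquareNondegeneracy := stub_squareNondegeneracy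
theorem shearedMirrorDoubling_holds : ShearedMirrorDoubling := stub_shearedMirrorDoubling
theorem patternUniformisation_holds : PatternUniformisation := stub_patternUniformisation

/-! ### Name-keyed aliases of the six statements (the hypotheses of the composition) -/
namespace Registered

/-- Alias of `PairedMirrorDoubling` keyed by the registered stub name. -/
abbrev stub_pairedMirrorDoubling : Prop := PairedMirrorDoubling
/-- Alias of `CrossingCalculus` keyed by the registered stub name. -/
abbrev stub_crossingCalculus : Prop := CrossingCalculus
/-- Alias of `IsotropicInvariance` keyed by the registered stub name. -/
abbrev stub_isotropicInvariance : Prop := IsotropicInvariance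
/-- Alias of `SquareNondegeneracy` keyed by the registered stub name. -/
abbrev stub_squareNondegeneracy : Prop := SquareNondegeneracy
/-- Alias of `ShearedMirrorDoubling` keyed by the registered stub name. -/
abbrev stub_shearedMirrorDoubling : Prop := ShearedMirrorDoubling
/-- Alias of `PatternUniformisation` keyed by the registered stub name. -/
abbrev stub_patternUniformisation : Prop := PatternUniformisation

end Registered

/-! ## §5 Proved glue: iterate the lever from the exact square value `1/2` and transport to every
isotropic-pure box -/

/-- Width reached after `k` doublings of a square of side `h`: `dblWidth 0 h = h`,
`dblWidth (k+1) h = 2 · dblWidth k h + 1` (`= 2^k (h+1) − 1`). -/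
def dblWidth : ℕ → ℕ → ℕ
  | 0, h => h
  | k + 1, h => 2 * dblWidth k h + 1

@[simp] theorem dblWidth_zero (h : ℕ) : dblWidth 0 h = h := rfl
@[simp] theorem dblWidth_succ (k h : ℕ) : dblWidth (k + 1) h = 2 * dblWidth k h + 1 := rfl

/-- `k` doublings reach aspect ratio at least `k + 1`. -/
theorem succ_mul_le_dblWidth (k h : ℕ) : (k + 1) * h ≤ dblWidth k h := by
  induction k with
  | zero => simp
  | succ k ih =>
    rw [dblWidth_succ]
    have h1 : (k + 1 + 1) * h = (k + 1) * h + h := by ring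
    have h2 : h ≤ (k + 1) * h := Nat.le_mul_of_pos_left h (Nat.succ_pos k)
    omega

/-- The EXACT square value of the isotropic model: `P_univ[LR(n × n)] = 1/2` for `n ≥ 2`
(duality, stub 2(a), + quarter turn, stub 3(b)). -/
theorem pLR_square_univ (hC : CrossingCalculus) (hI : IsotropicInvariance) {n : ℕ} (hn : 2 ≤ n) :
    pLR Set.univ 0 0 n n = 1 / 2 := by
  have h1 := hC.1 Set.univ 0 0 n n hn hn
  have h2 := hI.2 n n
  linarith

/-- Iterating the lever: after `k` doublings the `dblWidth k h × h` boxes of the isotropic model are LR-crossed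
with probability `≥ c_k > 0`, uniformly in `h ≥ 2`. -/
theorem pLR_dblWidth_univ (hE : PairedMirrorDoubling) (hC : CrossingCalculus) (hI : IsotropicInvariance) :
    ∀ k : ℕ, ∃ c : ℝ, 0 < c ∧ ∀ h : ℕ, 2 ≤ h → c ≤ pLR Set.univ 0 0 (dblWidth k h) h := by
  intro k
  induction k with
  | zero =>
    refine ⟨1 / 2, by norm_num, fun h hh => ?_⟩
    rw [dblWidth_zero, pLR_square_univ hC hI hh]
  | succ k ih =>
    obtain ⟨c, hc, hk⟩ := ih
    obtain ⟨c', hc', hstep⟩ := hE c hc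
    refine ⟨c', hc', fun h hh => ?_⟩
    rw [dblWidth_succ]
    have hw : 1 ≤ dblWidth k h := by
      have h1 := succ_mul_le_dblWidth k h
      have h2 : h ≤ (k + 1) * h := Nat.le_mul_of_pos_left h (Nat.succ_pos k)
      omega
    exact hstep 0 0 (dblWidth k h) h hw hh (hk h hh)

/-- Stubs 1–3 give RSW for isotropic-pure boxes at every aspect ratio, both directions, every position. -/
theorem isotropicRSW_of (hE : PairedMirrorDoubling) (hC : CrossingCalculus) (hI : IsotropicInvariance) :
    IsotropicRSW := by
  intro k
  obtain ⟨c, hc, hk⟩ := pLR_dblWidth_univ hE hC hI k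
  have key : ∀ w h : ℕ, 2 ≤ h → h ≤ w → w ≤ k * h → c ≤ pLR Set.univ 0 0 w h := by
    intro w h hh hhw hwk
    have hle : w ≤ dblWidth k h := by
      have h1 := succ_mul_le_dblWidth k h
      have h2 : k * h ≤ (k + 1) * h := Nat.mul_le_mul_right h (Nat.le_succ k)
      omega
    calc c ≤ pLR Set.univ 0 0 (dblWidth k h) h := hk h hh
      _ ≤ pLR Set.univ 0 0 w h := hC.2.1 Set.univ 0 0 w (dblWidth k h) h (by omega) hle
  refine ⟨c, hc, ?_, ?_⟩
  · intro S a b w h hh hhw hwk hiso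
    rw [(hI.1 S a b w h hiso).1]
    exact key w h hh hhw hwk
  · intro S a b w h hw hwh hhk hiso
    rw [(hI.1 S a b w h hiso).2, hI.2 w h]
    exact key h w hw hwh hhk

/-! ## §6 The composition: the six stubs imply the crux, BY NAME (both copies of the decl) -/

/-- **`IKMixedBoxCrossing_of`** — the glue of the line (no `sorry`), concluding the item's HOME decl
`CardyDiluteOrbit.IKMixedBoxCrossing` by name: stubs 1–3 give `IsotropicRSW` (`isotropicRSW_of`); stub 6 turns it,
with stubs 4–5, into the named form of the crux; `iff_cbox` is definitional. -/
theorem IKMixedBoxCrossing_of (h1 : Registered.stub_pairedMirrorDoubling) (h2 : Registered.stub_crossingCalculus)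
    (h3 : Registered.stub_isotropicInvariance) (h4 : Registered.stub_squareNondegeneracy)
    (h5 : Registered.stub_shearedMirrorDoubling) (h6 : Registered.stub_patternUniformisation) :
    Summit.CriticalPhenomena.CardyFormulaZ2.Theses.CardyDiluteOrbit.IKMixedBoxCrossing :=
  iff_cbox.2 (h6 (isotropicRSW_of h1 h2 h3) h4 h5)

/-- **`IKMixedBoxCrossing_of_CardyIKTransport`** — the same composition concluding this unit's payload-route copy
`CardyIKTransport.IKMixedBoxCrossing` by name (the only theorem of the file doing so). -/
theorem IKMixedBoxCrossing_of_CardyIKTransport (h1 : Registered.stub_pairedMirrorDoubling)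
    (h2 : Registered.stub_crossingCalculus) (h3 : Registered.stub_isotropicInvariance)
    (h4 : Registered.stub_squareNondegeneracy) (h5 : Registered.stub_shearedMirrorDoubling)
    (h6 : Registered.stub_patternUniformisation) :
    Summit.CriticalPhenomena.CardyFormulaZ2.Theses.CardyIKTransport.IKMixedBoxCrossing :=
  iff_cbox_transport.2 (h6 (isotropicRSW_of h1 h2 h3) h4 h5)

/-- Wiring check: the registered stubs feed `IKMixedBoxCrossing_of` as stated (the verbatim restatements are
definitionally the named statements).  When all six stubs land this is the sorry-free proof to propose
`--workitem stmt-CriticalPhenomena-5911`; it is an `example` so that `IKMixedBoxCrossing_of` stays the only theorem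
of the file concluding the home decl. -/
example : Summit.CriticalPhenomena.CardyFormulaZ2.Theses.CardyDiluteOrbit.IKMixedBoxCrossing :=
  IKMixedBoxCrossing_of stub_pairedMirrorDoubling stub_crossingCalculus stub_isotropicInvariance
    stub_squareNondegeneracy stub_shearedMirrorDoubling stub_patternUniformisation

/-! ## §7 Consistency with the LANDED Negative lemmas (cdisprove, `Theorems/IKMixedBoxCrossing/Negative/*`) -/

section Consistency

open Summit.CriticalPhenomena.CardyFormulaZ2.Theorems.IKMixedBoxCrossing.Negative (pH pV iff_named c_le_quarter)

/-- Stub 6's conclusion (the RHS of `iff_cbox`) is, up to the two definitional bridges, the disprover's named form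
of the crux (`Negative.iff_named` over `pH`/`pV`). -/
theorem namedForm_iff_disproverForm :
    (∃ c : ℝ, 0 < c ∧ ∀ S : Set ℤ, ∀ n : ℕ, 1 ≤ n → ∀ a b : ℤ, c ≤ pLR S a b (2 * n) n ∧ c ≤ pTB S a b n (2 * n)) ↔
    (∃ c : ℝ, 0 < c ∧ ∀ S : Set ℤ, ∀ n : ℕ, 1 ≤ n → ∀ a b : ℤ, c ≤ pH S n a b ∧ c ≤ pV S n a b) :=
  iff_cbox_transport.symm.trans iff_named

/-- The aspect-2 probabilities of this file ARE the disprover's `pH`/`pV` (definitional unfolding). -/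
theorem pLR_two_mul_eq_pH (S : Set ℤ) (n : ℕ) (a b : ℤ) : pLR S a b (2 * n) n = pH S n a b := by
  simp only [pLR, pH, lrEvent, cbox, sideW, sideE, edges, blk, anti, par, μIK,
    Summit.CriticalPhenomena.CardyFormulaZ2.Theorems.IKMixedBoxCrossing.Negative.hEvent,
    Summit.CriticalPhenomena.CardyFormulaZ2.Theorems.IKMixedBoxCrossing.Negative.edges,
    Summit.CriticalPhenomena.CardyFormulaZ2.Theorems.IKMixedBoxCrossing.Negative.blackSet,
    Summit.CriticalPhenomena.CardyFormulaZ2.Theorems.IKMixedBoxCrossing.Negative.antiSet,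
    Summit.CriticalPhenomena.CardyFormulaZ2.Theorems.IKMixedBoxCrossing.Negative.parSet,
    Summit.CriticalPhenomena.CardyFormulaZ2.Theorems.IKMixedBoxCrossing.Negative.μIK,
    Set.mem_setOf_eq, Nat.cast_mul, Nat.cast_ofNat]

theorem pTB_two_mul_eq_pV (S : Set ℤ) (n : ℕ) (a b : ℤ) : pTB S a b n (2 * n) = pV S n a b := by
  simp only [pTB, pV, tbEvent, cbox, sideS, sideN, edges, blk, anti, par, μIK,
    Summit.CriticalPhenomena.CardyFormulaZ2.Theorems.IKMixedBoxCrossing.Negative.vEvent,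
    Summit.CriticalPhenomena.CardyFormulaZ2.Theorems.IKMixedBoxCrossing.Negative.edges,
    Summit.CriticalPhenomena.CardyFormulaZ2.Theorems.IKMixedBoxCrossing.Negative.blackSet,
    Summit.CriticalPhenomena.CardyFormulaZ2.Theorems.IKMixedBoxCrossing.Negative.antiSet,
    Summit.CriticalPhenomena.CardyFormulaZ2.Theorems.IKMixedBoxCrossing.Negative.parSet,
    Summit.CriticalPhenomena.CardyFormulaZ2.Theorems.IKMixedBoxCrossing.Negative.μIK,
    Set.mem_setOf_eq, Nat.cast_mul, Nat.cast_ofNat]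

/-- TIGHTNESS respected (landed `Negative.c_le_quarter`): any constant admissible in the named form is `≤ 1/4`;
the refuted strengthening `Negative.not_IKMixedBoxCrossing_with_large_constant` is therefore never approached by
stub 6, whose constant is existential. -/
theorem namedForm_c_le_quarter {c : ℝ}
    (h : ∀ S : Set ℤ, ∀ n : ℕ, 1 ≤ n → ∀ a b : ℤ, c ≤ pLR S a b (2 * n) n ∧ c ≤ pTB S a b n (2 * n)) :
    c ≤ 1 / 4 :=
  c_le_quarter fun S n hn a b => by rw [← pLR_two_mul_eq_pH, ← pTB_two_mul_eq_pV]; exact h S n hn a b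

end Consistency

end Summit.CriticalPhenomena.CardyFormulaZ2.Cruxes.IKMixedBoxCrossing.PairedMirrorExploration

end
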